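import Summits.NavierStokesRegularity.FluidComputer.ClayBlowupForcedVorticityCriteria
import Summits.NavierStokesRegularity.FluidComputer.ClayBlowupForcedLeraySupRate
import Summits.NavierStokesRegularity.FluidComputer.ClayBlowupForcedStrainCriteria
import HarnessLib

/-!
# THE FORCED PORTRAIT: the vorticity / strain / sup-rate rows of EVERY Clay blow-up WITH its Clay force,
# in ONE theorem (companion of g8's `ClayBlowup.portrait`)

Cell `ns-blowup`, seat `ns-blowup-ecbridge-2` (g9; the E–C endpoint theory seat). LABEL: E–C typing
(KERNEL — no named fact). WHAT THIS IS NOT: not Navier–Stokes evidence — necessary conditions on the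
TYPE `ClayBlowup ν` (no inhabitant is claimed anywhere), hence on every breakdown scenario for
Fefferman's (C). Companion memo: `run/shared/lean/pub/ns-blowup/ecbridge2/ECBRIDGE-2-MEMO-8.md`.

g8's `ClayBlowup.portrait` is the twelve-row checklist of the (C) type (energy, dissipation, Sohr corner,
Type-II floor, far field, singular slice, CKN and gradient concentration, maximality). The rows that g8
could state only for UNFORCED inhabitants — Beale–Kato–Majda, Constantin–Fefferman, Beirão da Veiga,
Miller, Leray's `L^∞` clock at every instant — are FORCED theorems after g9. **`ClayBlowup.forced_portrait`**
conjoins them for by-name citation: for `X : ClayBlowup ν`, `ν > 0`, ANY Clay force,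
(1) `∫₀ᵀ‖curl u‖_∞ = ∞`; (2) `∫₀ᵀ‖∇u‖_∞ = ∞`; (3) no vorticity rate `C(T−t)^{−γ}`, `γ < 1`;
(4) Constantin–Fefferman incoherence for every `Ω, ρ > 0`; (5) Leray's clock
`√(cν/(T−t)) − (T−t)F ≤ ‖u(t)‖_∞` at every `t < T`; (6) `∇u ∉ L^q_tL^r_x`, `1 < q < ∞`,
`2/q + 3/r = 2`; (7) no integrable two-frame majorant of the middle principal strain in
`L^{2q/(2q−3)}_t L^q_x`, `q > 3/2`. Plus the `DesignedBlowup` twin and the (C)-reading.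

References: Beale–Kato–Majda 1984 [cite: BealeKatoMajda1984, Theorem 1]; Constantin–Fefferman 1993
[cite: ConstantinFeffermanIndiana1993, Theorem (§1)]; Leray 1934 (3.16) [cite: Leray1934, (3.16)];
Berselli–Galdi 2002 (1.3) [cite: BerselliGaldi2002, (1.3) p. 3586]; Miller 2020 [cite: Miller2019, Thm 1.1];
Fefferman (C) [cite: FeffermanClay2006, (C)].
-/

noncomputable section

namespace Summit.NavierStokesRegularity.FluidComputer

open Set MeasureTheory Filter Topology Function Metric
open scoped ENNReal ContDiff NNReal
open Literature.Analysis.FluidPDE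
open Summit.NavierStokesRegularity.NavierStokesRegularity

namespace ClayBlowup

variable {ν : ℝ} (X : ClayBlowup ν)

/-- **THE FORCED PORTRAIT OF A CLAY BLOW-UP** (`ν > 0`, ANY Clay force; no named fact): the seven
vorticity / strain / sup-rate rows that hold WITH the force — (1) BKM, (2) gradient-sup form, (3) the BKM
floor, (4) Constantin–Fefferman, (5) Leray's `L^∞` clock at every instant up to `(T−t)·sup|P f|`,
(6) Beirão da Veiga's gradient scale, (7) Miller's middle eigenvalue. Cite this one name for the forced
checklist (g8's `portrait` carries the force-free-of-hypothesis rows K1/K2/K5–K7/K13/structure).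
[cite: BealeKatoMajda1984, Theorem 1] [cite: ConstantinFeffermanIndiana1993, Theorem (§1)]
[cite: Leray1934, (3.16)] [cite: BerselliGaldi2002, (1.3) p. 3586] [cite: Miller2019, Thm 1.1] -/
theorem forced_portrait (hν : 0 < ν) :
    (∫⁻ t in Ioo 0 X.T, ⨆ x, ‖curl (X.u t) x‖ₑ) = ⊤ ∧
    (∫⁻ t in Ioo 0 X.T, ⨆ x, ‖fderiv ℝ (X.u t) x‖ₑ) = ⊤ ∧
    (∀ C γ : ℝ, 0 ≤ C → γ < 1 →
      ¬ ∀ t ∈ Ioo 0 X.T, ∀ x, ‖curl (X.u t) x‖ ≤ C * (X.T - t) ^ (-γ)) ∧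
    (∀ Ω ρ : ℝ, 0 < Ω → 0 < ρ →
      ∃ t ∈ Ico 0 X.T, ∃ x y : EuclideanSpace ℝ (Fin 3),
        Ω < ‖curl (X.u t) x‖ ∧ Ω < ‖curl (X.u t) y‖ ∧
          ‖x - y‖ / ρ <
            Real.sqrt (1 - inner ℝ (vorticityDirection (curl (X.u t)) x)
              (vorticityDirection (curl (X.u t)) y) ^ 2)) ∧
    (∃ c : ℝ, 0 < c ∧ ∃ F : ℝ, 0 ≤ F ∧ ∀ t ∈ Ico 0 X.T,
      ENNReal.ofReal (Real.sqrt (c * ν / (X.T - t)) - (X.T - t) * F) ≤ eLpNorm (X.u t) ⊤ volume) ∧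
    (∀ q r : ℝ≥0∞, 1 < q → q < ⊤ → 2 / q + 3 / r = 2 →
      ¬ MemLqLp q r (fun t x => fderiv ℝ (X.u t) x) (Ioo 0 X.T)) ∧
    (∀ q : ℝ, 3 / 2 < q → ∀ m : ℝ → EuclideanSpace ℝ (Fin 3) → ℝ, (∀ t x, 0 ≤ m t x) →
      (∀ t ∈ Ico 0 X.T, ∀ x, ∃ v w : EuclideanSpace ℝ (Fin 3),
        ‖v‖ = 1 ∧ ‖w‖ = 1 ∧ inner ℝ v w = 0 ∧
          ∀ α β : ℝ, inner ℝ (fderiv ℝ (X.u t) x (α • v + β • w)) (α • v + β • w)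
            ≤ m t x * (α ^ 2 + β ^ 2)) →
      ¬ (∫⁻ t in Ioo 0 X.T, (∫⁻ x, ENNReal.ofReal (m t x) ^ q) ^ (2 / (2 * q - 3)) < ⊤)) :=
  ⟨X.lintegral_vorticity_sup_eq_top_forced hν, X.lintegral_gradient_sup_eq_top_forced hν,
    fun _ _ hC hγ hrate => X.not_subBKMRate hν hC hγ hrate,
    fun _ _ hΩ hρ => X.vorticityDirection_incoherent_forced hν hΩ hρ,
    X.forced_leray_rate_sup hν,
    fun _ _ h1q hq hqr => X.gradient_not_memLqLp_forced hν h1q hq hqr,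
    fun _ hq _ hm0 hdom => X.middleEigenvalue_not_integrable_forced hν hq hm0 hdom⟩

end ClayBlowup

namespace DesignedBlowup

variable {ν : ℝ} (D : DesignedBlowup ν)

/-- **The forced portrait of a designed blow-up** (through `toClayBlowup`).
[cite: BealeKatoMajda1984, Theorem 1] [cite: Leray1934, (3.16)] -/
theorem forced_portrait (hν : 0 < ν) :
    (∫⁻ t in Ioo 0 D.T, ⨆ x, ‖curl (D.u t) x‖ₑ) = ⊤ ∧
    (∫⁻ t in Ioo 0 D.T, ⨆ x, ‖fderiv ℝ (D.u t) x‖ₑ) = ⊤ ∧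
    (∀ C γ : ℝ, 0 ≤ C → γ < 1 →
      ¬ ∀ t ∈ Ioo 0 D.T, ∀ x, ‖curl (D.u t) x‖ ≤ C * (D.T - t) ^ (-γ)) ∧
    (∀ Ω ρ : ℝ, 0 < Ω → 0 < ρ →
      ∃ t ∈ Ico 0 D.T, ∃ x y : EuclideanSpace ℝ (Fin 3),
        Ω < ‖curl (D.u t) x‖ ∧ Ω < ‖curl (D.u t) y‖ ∧
          ‖x - y‖ / ρ <
            Real.sqrt (1 - inner ℝ (vorticityDirection (curl (D.u t)) x)
              (vorticityDirection (curl (D.u t)) y) ^ 2)) ∧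
    (∃ c : ℝ, 0 < c ∧ ∃ F : ℝ, 0 ≤ F ∧ ∀ t ∈ Ico 0 D.T,
      ENNReal.ofReal (Real.sqrt (c * ν / (D.T - t)) - (D.T - t) * F) ≤ eLpNorm (D.u t) ⊤ volume) ∧
    (∀ q r : ℝ≥0∞, 1 < q → q < ⊤ → 2 / q + 3 / r = 2 →
      ¬ MemLqLp q r (fun t x => fderiv ℝ (D.u t) x) (Ioo 0 D.T)) ∧
    (∀ q : ℝ, 3 / 2 < q → ∀ m : ℝ → EuclideanSpace ℝ (Fin 3) → ℝ, (∀ t x, 0 ≤ m t x) →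
      (∀ t ∈ Ico 0 D.T, ∀ x, ∃ v w : EuclideanSpace ℝ (Fin 3),
        ‖v‖ = 1 ∧ ‖w‖ = 1 ∧ inner ℝ v w = 0 ∧
          ∀ α β : ℝ, inner ℝ (fderiv ℝ (D.u t) x (α • v + β • w)) (α • v + β • w)
            ≤ m t x * (α ^ 2 + β ^ 2)) →
      ¬ (∫⁻ t in Ioo 0 D.T, (∫⁻ x, ENNReal.ofReal (m t x) ^ q) ^ (2 / (2 * q - 3)) < ⊤)) :=
  D.toClayBlowup.forced_portrait hν

end DesignedBlowup

/-- **Every breakdown scenario for (C) satisfies the forced portrait** (no named fact): if Fefferman's (C)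
holds then at every `ν > 0` there is a Clay blow-up with all seven forced rows.
[cite: FeffermanClay2006, (C)] [cite: BealeKatoMajda1984, Theorem 1] -/
theorem clayBlowup_forced_portrait_of_navierStokesBreakdownR3
    (h : Summit.NavierStokesRegularity.NavierStokesRegularity.NavierStokesBreakdownR3)
    {ν : ℝ} (hν : 0 < ν) :
    ∃ X : ClayBlowup ν,
      (∫⁻ t in Ioo 0 X.T, ⨆ x, ‖curl (X.u t) x‖ₑ) = ⊤ ∧
      (∫⁻ t in Ioo 0 X.T, ⨆ x, ‖fderiv ℝ (X.u t) x‖ₑ) = ⊤ ∧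
      (∀ C γ : ℝ, 0 ≤ C → γ < 1 →
        ¬ ∀ t ∈ Ioo 0 X.T, ∀ x, ‖curl (X.u t) x‖ ≤ C * (X.T - t) ^ (-γ)) ∧
      (∀ Ω ρ : ℝ, 0 < Ω → 0 < ρ →
        ∃ t ∈ Ico 0 X.T, ∃ x y : EuclideanSpace ℝ (Fin 3),
          Ω < ‖curl (X.u t) x‖ ∧ Ω < ‖curl (X.u t) y‖ ∧
            ‖x - y‖ / ρ <
              Real.sqrt (1 - inner ℝ (vorticityDirection (curl (X.u t)) x)
                (vorticityDirection (curl (X.u t)) y) ^ 2)) ∧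
      (∃ c : ℝ, 0 < c ∧ ∃ F : ℝ, 0 ≤ F ∧ ∀ t ∈ Ico 0 X.T,
        ENNReal.ofReal (Real.sqrt (c * ν / (X.T - t)) - (X.T - t) * F) ≤ eLpNorm (X.u t) ⊤ volume) ∧
      (∀ q r : ℝ≥0∞, 1 < q → q < ⊤ → 2 / q + 3 / r = 2 →
        ¬ MemLqLp q r (fun t x => fderiv ℝ (X.u t) x) (Ioo 0 X.T)) ∧
      (∀ q : ℝ, 3 / 2 < q → ∀ m : ℝ → EuclideanSpace ℝ (Fin 3) → ℝ, (∀ t x, 0 ≤ m t x) →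
        (∀ t ∈ Ico 0 X.T, ∀ x, ∃ v w : EuclideanSpace ℝ (Fin 3),
          ‖v‖ = 1 ∧ ‖w‖ = 1 ∧ inner ℝ v w = 0 ∧
            ∀ α β : ℝ, inner ℝ (fderiv ℝ (X.u t) x (α • v + β • w)) (α • v + β • w)
              ≤ m t x * (α ^ 2 + β ^ 2)) →
        ¬ (∫⁻ t in Ioo 0 X.T, (∫⁻ x, ENNReal.ofReal (m t x) ^ q) ^ (2 / (2 * q - 3)) < ⊤)) := by
  obtain ⟨X⟩ := forall_nonempty_clayBlowup_of_breakdownR3 h ν hν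
  exact ⟨X, X.forced_portrait hν⟩

end Summit.NavierStokesRegularity.FluidComputer

end
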